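import Summits.AtomisticToContinuum.HydrodynamicLimit.Theorems.LocalSecondLaw.Negative.EquilibriumL1
import Summits.AtomisticToContinuum.HydrodynamicLimit.Theorems.LocalSecondLaw.Negative.TimeIntegral
import Summits.AtomisticToContinuum.HydrodynamicLimit.Theorems.LocalSecondLaw.Negative.FalseWithoutLLN
import Summits.AtomisticToContinuum.HydrodynamicLimit.Theorems.LocalSecondLaw.Negative.FreeVolume
import Summits.AtomisticToContinuum.HydrodynamicLimit.Theorems.LocalSecondLaw.Negative.HomogeneousLLN
import Literature.Analysis.FluidPDE.HardSphereAlexander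

/-!
# `LocalSecondLaw` is TIGHT at equilibrium: no positive entropy gap, however small

Negative knowledge for the crux `JParityClosure.LocalSecondLaw` (stmt-AtomisticToContinuum-13081), from the
standing disprover's `Cruxes/LocalSecondLaw/Disproof.lean` (tightness programme, step E).  `LocalSecondLawGapAt c`
is the crux VERBATIM with the event `{I + init < -η}` replaced by `{I + init < c}` for a FIXED `c`;
`LocalSecondLawStrictGap` replaces it by `{I + init < η}`.  Both are FALSE: `not_localSecondLawGapAt` for EVERY
`c > 0` (sorry-free) and `not_localSecondLawStrictGap` as its corollary.  Witness: homogeneous unit local Gibbs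
data with the MATCHED constant Euler state `(1,0,1)` (`homogeneous_lln_identified`), Alexander's flows,
`φ(s,x) = ψ(s)`, `τ = 1`, `δ = 1/2`, `σ` so small that `f_ex(σ³) ≤ c/4` (`exists_sigma_fex_le`, from the landed
explicit EOS bound), `r = min(r₀/2, 1/4)`: on `Φ.good` `I ≤ J := ∫₀¹(-ψ')Dev(Φₛ·)`
(`entropyFunctional_le_Dev`), `E_N[J] = E_N[Dev] → 0` (`lintegral_timeIntegral_Dev_eq`, `tendsto_lintegral_Dev`),
and Markov at `c/2` gives `P_N(J ≥ c/2) < 1/4` eventually, so `P_N(I + init < c) > 3/4 > 1/2`.  Moral for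
provers: the inequality is saturated at global equilibrium; every estimate in a proof of the crux must be sharp
there, and no argument producing a uniform positive entropy production can be correct.  refuter-cdisprove-stmt-AtomisticToContinuum-13081-0.
-/

noncomputable section

namespace Summit.AtomisticToContinuum.HydrodynamicLimit.Theorems.LocalSecondLawNegative

open MeasureTheory Filter Set Topology
open scoped ENNReal
open Literature.MathematicalPhysics.KineticTheory Literature.Analysis.FluidPDE

variable {N : ℕ}

/-- `f_ex(σ³) ≤ 1/10` for `0 ≤ σ ≤ 1/4` (from the landed explicit bound). [folklore] -/
theorem hsExcessFreeEnergy_le_tenth {σ : ℝ} (hσ0 : 0 ≤ σ) (hσ : σ ≤ 1 / 4) :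
    hsExcessFreeEnergy (σ ^ 3) ≤ 1 / 10 := by
  have hpi3 := Real.pi_gt_three
  have hpi := Real.pi_lt_d2
  have hσ3 : σ ^ 3 ≤ 1 / 64 := by nlinarith [pow_le_pow_left₀ hσ0 hσ 3]
  have hx : 4 * Real.pi / 3 * σ ^ 3 ≤ 7 / 100 := by nlinarith [pow_nonneg hσ0 3]
  have h1 := hsExcessFreeEnergy_le (pow_nonneg hσ0 3) (by linarith)
  have hpos : 0 < 1 - 4 * Real.pi / 3 * σ ^ 3 := by linarith
  have h2 : 1 - (1 - 4 * Real.pi / 3 * σ ^ 3)⁻¹ ≤ Real.log (1 - 4 * Real.pi / 3 * σ ^ 3) :=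
    Real.one_sub_inv_le_log_of_pos hpos
  have h3 : (1 - 4 * Real.pi / 3 * σ ^ 3)⁻¹ ≤ 100 / 93 := by
    rw [inv_le_comm₀ hpos (by norm_num)]; linarith
  linarith

/-- The weighted time integral of `Dev` is a.e.-measurable in the configuration (measurable through the
modification by Fubini measurability, equal to it on `Φ.good`). [folklore] -/
theorem aemeasurable_timeIntegral_Dev {σ : ℝ} (r : ℝ) (N : ℕ)
    (Φ : HardSphereFlow (Torus.geometry (Fin 3)) (hsDiameter σ N) (N + 1))
    {ψ : ℝ → ℝ} (hψc : Continuous (deriv ψ)) :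
    AEMeasurable (fun z => ENNReal.ofReal (∫ s in Set.Icc (0 : ℝ) 1, -deriv ψ s * Dev r (Φ.flow s z)))
      (localGibbsLaw σ (fun _ => 1) (fun _ => 0) (fun _ => 1) N Φ) := by
  have hfm : Measurable fun p : Config (N + 1) (Fin 3) T3 × ℝ => -deriv ψ p.2 * Dev r (flowReg Φ p) :=
    (hψc.measurable.comp measurable_snd).neg.mul ((continuous_Dev r).measurable.comp (measurable_flowReg Φ))
  have hsm : StronglyMeasurable fun p : Config (N + 1) (Fin 3) T3 × ℝ => -deriv ψ p.2 * Dev r (flowReg Φ p) :=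
    hfm.stronglyMeasurable
  have hJm : Measurable fun z : Config (N + 1) (Fin 3) T3 =>
      ∫ s, -deriv ψ s * Dev r (flowReg Φ (z, s)) ∂((volume : Measure ℝ).restrict (Set.Icc (0 : ℝ) 1)) :=
    (hsm.integral_prod_right' (ν := (volume : Measure ℝ).restrict (Set.Icc (0 : ℝ) 1))).measurable
  have hgood : ∀ᵐ z ∂(localGibbsLaw σ (fun _ => 1) (fun _ => 0) (fun _ => 1) N Φ), z ∈ Φ.good :=
    (withDensity_absolutelyContinuous (μ := liouville (Torus.geometry (Fin 3)) (N + 1)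
      (hsDiameter σ N)) _).ae_le Φ.ae_mem_good
  refine ⟨fun z => ENNReal.ofReal (∫ s, -deriv ψ s * Dev r (flowReg Φ (z, s))
    ∂((volume : Measure ℝ).restrict (Set.Icc (0 : ℝ) 1))), hJm.ennreal_ofReal, ?_⟩
  filter_upwards [hgood] with z hz
  simp only [flowReg_of_mem Φ hz]


/-- For every `c > 0` a smallness threshold making the boundary term `f_ex(σ³) ≤ c/4`. [folklore] -/
theorem exists_sigma_fex_le {c : ℝ} (hc : 0 < c) :
    ∃ σq : ℝ, 0 < σq ∧ σq ≤ 1 / 4 ∧ ∀ σ : ℝ, 0 ≤ σ → σ ≤ σq → hsExcessFreeEnergy (σ ^ 3) ≤ c / 4 := by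
  refine ⟨min (1 / 4) (c / 40), lt_min (by norm_num) (by positivity), min_le_left _ _, fun σ hσ0 hσ => ?_⟩
  have hσ4 : σ ≤ 1 / 4 := hσ.trans (min_le_left _ _)
  have hσc : σ ≤ c / 40 := hσ.trans (min_le_right _ _)
  by_cases hcl : 2 / 5 ≤ c
  · exact (hsExcessFreeEnergy_le_tenth hσ0 hσ4).trans (by linarith)
  · rw [not_le] at hcl
    have hpi := Real.pi_lt_d2
    have hpi3 := Real.pi_gt_three
    have hσ2 : σ ^ 2 ≤ 1 / 16 := by nlinarith
    have hσ3 : σ ^ 3 ≤ c / 640 := by nlinarith [pow_nonneg hσ0 2]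
    have hx : 4 * Real.pi / 3 * σ ^ 3 ≤ c / 150 := by nlinarith [pow_nonneg hσ0 3]
    have hx1 : 4 * Real.pi / 3 * σ ^ 3 < 1 / 2 := by linarith
    have h1 := hsExcessFreeEnergy_le (pow_nonneg hσ0 3) (by linarith)
    have hpos : 0 < 1 - 4 * Real.pi / 3 * σ ^ 3 := by linarith
    have h2 : 1 - (1 - 4 * Real.pi / 3 * σ ^ 3)⁻¹ ≤ Real.log (1 - 4 * Real.pi / 3 * σ ^ 3) :=
      Real.one_sub_inv_le_log_of_pos hpos
    have hxnn : 0 ≤ 4 * Real.pi / 3 * σ ^ 3 := by positivity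
    have h3 : (1 - 4 * Real.pi / 3 * σ ^ 3)⁻¹ ≤ 1 + 2 * (4 * Real.pi / 3 * σ ^ 3) := by
      rw [inv_le_iff_one_le_mul₀ hpos]
      nlinarith
    linarith

/-- The crux with the event `{I + init < -η}` replaced by `{I + init < c}` for a FIXED gap `c`
(the quantified `η` is then idle).  `LocalSecondLawGapAt c` for some `c > 0` would be a uniform positive
entropy production at the Euler scale. -/
def LocalSecondLawGapAt (c : ℝ) : Prop :=
  ∀ (a₀ θ₀ : Literature.MathematicalPhysics.KineticTheory.T3 → ℝ) (u₀ : Literature.MathematicalPhysics.KineticTheory.T3 → Literature.MathematicalPhysics.KineticTheory.V3), Continuous a₀ → Continuous θ₀ → Continuous u₀ → (∀ x, 0 < a₀ x) → (∀ x, 0 < θ₀ x) → ∃ σ₀ : ℝ, 0 < σ₀ ∧ ∀ σ : ℝ, 0 < σ → σ < σ₀ → ∀ (T : ℝ) (ρ θ : ℝ → Literature.MathematicalPhysics.KineticTheory.T3 → ℝ) (u : ℝ → Literature.MathematicalPhysics.KineticTheory.T3 → Literature.MathematicalPhysics.KineticTheory.V3), Literature.MathematicalPhysics.KineticTheory.IsHardSphereEulerSolution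 σ T ρ u θ → ∀ Φ : (N : ℕ) → Literature.Analysis.FluidPDE.HardSphereFlow (Literature.Analysis.FluidPDE.Torus.geometry (Fin 3)) (Literature.MathematicalPhysics.KineticTheory.hsDiameter σ N) (N + 1), Literature.MathematicalPhysics.KineticTheory.TendstoHydroFieldsAt (fun N => Literature.MathematicalPhysics.KineticTheory.localGibbsLaw σ a₀ u₀ θ₀ N (Φ N)) Φ ρ u θ 0 → 0 < T → ∀ τ : ℝ, 0 < τ → ∀ φ : ℝ → Literature.MathematicalPhysics.KineticTheory.T3 → ℝ, Literature.Analysis.FunctionSpaces.Torus.IsSmoothSpaceTimeOn Set.univ φ → (∀ s x, 0 ≤ φ s x) → (∃ τ' : ℝ, τ' < τ ∧ ∀ s, τ' ≤ s → ∀ x, φ s x = 0) → ∀ η δ : ℝ, 0 < η → 0 < δ → ∃ r₀ : ℝ, 0 < r₀ ∧ ∀ r : ℝ, 0 < r → r < r₀ → ∃ N₀ : ℕ, ∀ N : ℕ, N₀ ≤ N → let γ : Literature.Analysis.FluidPDE.Config (N + 1) (Fin 3) Literature.MathematicalPhysics.KineticTheory.T3 → ℝ → Literature.Analysis.FluidPDE.Config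 (N + 1) (Fin 3) Literature.MathematicalPhysics.KineticTheory.T3 := fun z s => (Φ N).flow s z; let bx : Literature.MathematicalPhysics.KineticTheory.T3 → Literature.MathematicalPhysics.KineticTheory.T3 → ℝ := fun x y => 3 / (Real.pi * r ^ 3) * max (1 - Literature.Analysis.FluidPDE.Torus.euclidDist x y / r) 0; let ρm : Literature.Analysis.FluidPDE.Config (N + 1) (Fin 3) Literature.MathematicalPhysics.KineticTheory.T3 → ℝ → Literature.MathematicalPhysics.KineticTheory.T3 → ℝ := fun z s x₀ => ∫ q, bx q.1 x₀ ∂(Literature.Analysis.FluidPDE.empiricalMeasure (γ z s)); let mm : Literature.Analysis.FluidPDE.Config (N + 1) (Fin 3) Literature.MathematicalPhysics.KineticTheory.T3 → ℝ → Literature.MathematicalPhysics.KineticTheory.T3 → Literature.MathematicalPhysics.KineticTheory.V3 := fun z s x₀ => ∫ q, bx q.1 x₀ • q.2 ∂(Literature.Analysis.FluidPDE.empiricalMeasure (γ z s)); let em : Literature.Analysis.FluidPDE.Config (N + 1) (Fin 3) Literature.MathematicalPhysics.KineticTheory.T3 → ℝ → Literature.MathematicalPhysics.KineticTheory.T3 →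 ℝ := fun z s x₀ => ∫ q, bx q.1 x₀ * (‖q.2‖ ^ 2 / 2) ∂(Literature.Analysis.FluidPDE.empiricalMeasure (γ z s)); let θm : Literature.Analysis.FluidPDE.Config (N + 1) (Fin 3) Literature.MathematicalPhysics.KineticTheory.T3 → ℝ → Literature.MathematicalPhysics.KineticTheory.T3 → ℝ := fun z s x₀ => 2 / 3 * (em z s x₀ / ρm z s x₀ - ‖mm z s x₀‖ ^ 2 / (2 * ρm z s x₀ ^ 2)); let Hs : ℝ → ℝ → ℝ := fun a b => if 0 < a ∧ 0 < b then -(a * (3 / 2 * Real.log b - Real.log a - Literature.MathematicalPhysics.KineticTheory.hsExcessFreeEnergy (a * σ ^ 3))) else 0; let I : Literature.Analysis.FluidPDE.Config (N + 1) (Fin 3) Literature.MathematicalPhysics.KineticTheory.T3 → ℝ := fun z => ∫ s in Set.Icc (0 : ℝ) τ, ∫ x : Literature.MathematicalPhysics.KineticTheory.T3, Hs (ρm z s x) (θm z s x) * (deriv (fun s' => φ s' x) s + ∑ k : Fin 3, (mm z s x) k / ρm z s x * Literature.Analysis.FunctionSpaces.Torus.partialDeriv k (φ s) x); Literature.MathematicalPhysics.KineticTheory.localGibbsLaw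 σ a₀ u₀ θ₀ N (Φ N) {z | I z + ∫ x : Literature.MathematicalPhysics.KineticTheory.T3, Hs (ρ 0 x) (θ 0 x) * φ 0 x < c} ≤ ENNReal.ofReal δ

/-- **TIGHTNESS (sharp form): for every `c > 0` the `c`-gap strengthening of `LocalSecondLaw` is false** —
the local entropy inequality is SATURATED at global equilibrium.  Witness and proof as described in the
module docstring, with threshold `c`, Markov at `c/2`, and `σ` so small that `f_ex(σ³) ≤ c/4`
(`exists_sigma_fex_le`). [folklore] -/
theorem not_localSecondLawGapAt {c : ℝ} (hc : 0 < c) : ¬ LocalSecondLawGapAt c := by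
  intro h
  have hc1 : Continuous (fun _ : T3 => (1 : ℝ)) := continuous_const
  have hc0 : Continuous (fun _ : T3 => (0 : V3)) := continuous_const
  obtain ⟨σ₀, hσ₀, h1⟩ := h (fun _ => 1) (fun _ => 1) (fun _ => 0) hc1 hc1 hc0
    (fun _ => one_pos) (fun _ => one_pos)
  obtain ⟨σ₁, hσ₁, -, hL⟩ := homogeneous_lln_identified one_pos
  obtain ⟨σq, hσq0, hσq4, hfq⟩ := exists_sigma_fex_le hc
  obtain ⟨σ, hσpos, hσlt0, hσlt1, hσq⟩ : ∃ σ : ℝ, 0 < σ ∧ σ < σ₀ ∧ σ < σ₁ ∧ σ ≤ σq := by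
    refine ⟨min (min σ₀ σ₁) σq / 2, by positivity, ?_, ?_, ?_⟩ <;>
      linarith [min_le_left (min σ₀ σ₁) σq, min_le_right (min σ₀ σ₁) σq,
        min_le_left σ₀ σ₁, min_le_right σ₀ σ₁, lt_min (lt_min hσ₀ hσ₁) hσq0]
  have hσ4 : σ ≤ 1 / 4 := hσq.trans hσq4
  have hσhalf : σ ≤ 1 / 2 := by linarith
  have hσhalf' : σ < 2⁻¹ := by norm_num; linarith
  let Φ : (N : ℕ) → HardSphereFlow (Torus.geometry (Fin 3)) (hsDiameter σ N) (N + 1) := fun N =>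
    Classical.choice (HardSphereFlow.nonempty_torus_holds (d := Fin 3) (hsDiameter_pos hσpos N)
      (lt_of_le_of_lt (hsDiameter_le hσpos.le N) hσhalf') (N + 1))
  have hT := hL σ hσpos hσlt1 Φ
  have hprob : ∀ N, IsProbabilityMeasure (localGibbsLaw σ (fun _ => 1) (fun _ => 0) (fun _ => 1) N (Φ N)) :=
    fun N => isProbabilityMeasure_localGibbsLaw hc1 hc1 hc0 (fun _ => one_pos) (fun _ => one_pos)
      hσhalf N (Φ N)
  have hsol := constState_isSolution σ 1 one_pos
  have hsmooth : Literature.Analysis.FunctionSpaces.Torus.IsSmoothSpaceTimeOn Set.univ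
      (fun (s : ℝ) (_ : T3) => psi s) := by
    show ContDiffOn ℝ _ (fun p : ℝ × EuclideanSpace ℝ (Fin 3) => psi p.1) _
    exact (psi_contDiff.comp contDiff_fst).contDiffOn
  have hψd : Differentiable ℝ psi := (psi_contDiff (n := 1)).differentiable (by simp)
  have hψc : Continuous (deriv psi) := (psi_contDiff (n := 1)).continuous_deriv (by simp)
  obtain ⟨r₀, hr₀, h3⟩ := h1 σ hσpos hσlt0 1 (fun _ _ => 1) (fun _ _ => 1) (fun _ _ => 0) hsol Φ hT
    one_pos 1 one_pos (fun s _ => psi s) hsmooth (fun s _ => psi_nonneg s)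
    ⟨1 / 2, by norm_num, fun s hs _ => psi_eq_zero hs⟩ 1 (1 / 2) one_pos (by norm_num)
  have hc2 : (0 : ℝ) < c / 2 := by positivity
  set r : ℝ := min (r₀ / 2) (1 / 4) with hr
  have hrpos : 0 < r := by positivity
  have hrlt : r < r₀ := lt_of_le_of_lt (min_le_left _ _) (by linarith)
  have hr2 : r < 1 / 2 := lt_of_le_of_lt (min_le_right _ _) (by norm_num)
  obtain ⟨N₀, h4⟩ := h3 r hrpos hrlt
  -- the expected deviation tends to zero
  have hE := tendsto_lintegral_Dev (r := r) hrpos hr2 hσhalf Φ hT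
  have h9 : (0 : ℝ≥0∞) < ENNReal.ofReal (c / 2) / 4 :=
    ENNReal.div_pos (ENNReal.ofReal_pos.2 hc2).ne' (by norm_num)
  obtain ⟨N₁, hN₁⟩ := Filter.eventually_atTop.1 (hE.eventually (gt_mem_nhds h9))
  set N := max N₀ N₁ with hN
  have h5 := h4 N (le_max_left _ _)
  change localGibbsLaw σ (fun _ => 1) (fun _ => 0) (fun _ => 1) N (Φ N)
      {z | entropyFunctional σ r 1 (fun s _ => psi s) (Φ N) z +
        ∫ x : T3, Hs σ ((fun _ _ => (1 : ℝ)) 0 x) ((fun _ _ => (1 : ℝ)) 0 x) *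
          (fun (s : ℝ) (_ : T3) => psi s) 0 x < c} ≤ ENNReal.ofReal (1 / 2) at h5
  set LG := localGibbsLaw σ (fun _ => 1) (fun _ => 0) (fun _ => 1) N (Φ N) with hLGdef
  haveI : IsProbabilityMeasure LG := hprob N
  -- the boundary term
  have hHs : Hs σ 1 1 = hsExcessFreeEnergy (1 * σ ^ 3) := by
    unfold Hs
    rw [if_pos ⟨one_pos, one_pos⟩, Real.log_one]
    ring
  have hinit : (∫ x : T3, Hs σ ((fun _ _ => (1 : ℝ)) 0 x) ((fun _ _ => (1 : ℝ)) 0 x) *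
      (fun (s : ℝ) (_ : T3) => psi s) 0 x) = hsExcessFreeEnergy (1 * σ ^ 3) := by
    show (∫ _ : T3, Hs σ 1 1 * psi 0) = _
    rw [integral_const, psi_zero, mul_one, hHs]
    simp
  have hf : hsExcessFreeEnergy (1 * σ ^ 3) ≤ c / 4 := by
    rw [one_mul]; exact hfq σ hσpos.le hσq
  -- the sure inclusion on the good set
  have hAE : {z | z ∈ (Φ N).good ∧
      (∫ s in Set.Icc (0 : ℝ) 1, -deriv psi s * Dev r ((Φ N).flow s z)) < c / 2} ⊆
      {z | entropyFunctional σ r 1 (fun s _ => psi s) (Φ N) z +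
        ∫ x : T3, Hs σ ((fun _ _ => (1 : ℝ)) 0 x) ((fun _ _ => (1 : ℝ)) 0 x) *
          (fun (s : ℝ) (_ : T3) => psi s) 0 x < c} := by
    rintro z ⟨hzg, hzJ⟩
    rw [Set.mem_setOf_eq, hinit]
    have hI := entropyFunctional_le_Dev (σ := σ) hrpos hr2 (Φ N) hψc psi_antitone hzg
    linarith
  -- Markov for the bad set
  have hMarkov := mul_meas_ge_le_lintegral₀ (aemeasurable_timeIntegral_Dev r N (Φ N) hψc)
    (ENNReal.ofReal (c / 2))
  have hJint := lintegral_timeIntegral_Dev_eq (r := r) hrpos hr2 hσhalf N (Φ N) hψd hψc psi_antitone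
  rw [psi_zero, psi_eq_zero (by norm_num : (1 : ℝ) / 2 ≤ 1), sub_zero, ENNReal.ofReal_one, one_mul] at hJint
  have hB : LG {z | ENNReal.ofReal (c / 2) ≤ ENNReal.ofReal
      (∫ s in Set.Icc (0 : ℝ) 1, -deriv psi s * Dev r ((Φ N).flow s z))} < 4⁻¹ := by
    have hlt := hN₁ N (le_max_right _ _)
    have h6 : ENNReal.ofReal (c / 2) * LG {z | ENNReal.ofReal (c / 2) ≤ ENNReal.ofReal
        (∫ s in Set.Icc (0 : ℝ) 1, -deriv psi s * Dev r ((Φ N).flow s z))} <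
        ENNReal.ofReal (c / 2) * 4⁻¹ := by
      calc _ ≤ _ := hMarkov
        _ = _ := hJint
        _ < ENNReal.ofReal (c / 2) / 4 := hlt
        _ = ENNReal.ofReal (c / 2) * 4⁻¹ := div_eq_mul_inv _ _
    exact lt_of_not_ge fun hge => absurd h6 (not_lt.2 (by gcongr))
  -- complement of the sure set
  have hg0 : LG ((Φ N).good)ᶜ = 0 := by
    have hac : LG ≪ liouville (Torus.geometry (Fin 3)) (N + 1) (hsDiameter σ N) :=
      withDensity_absolutelyContinuous _ _
    exact hac (Φ N).measure_compl_good
  have hAc : {z | z ∈ (Φ N).good ∧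
      (∫ s in Set.Icc (0 : ℝ) 1, -deriv psi s * Dev r ((Φ N).flow s z)) < c / 2}ᶜ ⊆
      {z | ENNReal.ofReal (c / 2) ≤ ENNReal.ofReal
        (∫ s in Set.Icc (0 : ℝ) 1, -deriv psi s * Dev r ((Φ N).flow s z))} ∪ ((Φ N).good)ᶜ := by
    intro z hz
    by_cases hzg : z ∈ (Φ N).good
    · left
      have hJ : c / 2 ≤ ∫ s in Set.Icc (0 : ℝ) 1, -deriv psi s * Dev r ((Φ N).flow s z) := by
        by_contra hcon
        exact hz ⟨hzg, not_le.1 hcon⟩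
      exact ENNReal.ofReal_le_ofReal hJ
    · right; exact hzg
  -- measure bookkeeping in ℝ
  have h7 : (1 : ℝ≥0∞) ≤ LG {z | entropyFunctional σ r 1 (fun s _ => psi s) (Φ N) z +
        ∫ x : T3, Hs σ ((fun _ _ => (1 : ℝ)) 0 x) ((fun _ _ => (1 : ℝ)) 0 x) *
          (fun (s : ℝ) (_ : T3) => psi s) 0 x < c} +
      LG {z | ENNReal.ofReal (c / 2) ≤ ENNReal.ofReal
        (∫ s in Set.Icc (0 : ℝ) 1, -deriv psi s * Dev r ((Φ N).flow s z))} := by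
    rw [← measure_univ (μ := LG)]
    calc LG Set.univ ≤ LG ({z | z ∈ (Φ N).good ∧
          (∫ s in Set.Icc (0 : ℝ) 1, -deriv psi s * Dev r ((Φ N).flow s z)) < c / 2} ∪
          {z | z ∈ (Φ N).good ∧
          (∫ s in Set.Icc (0 : ℝ) 1, -deriv psi s * Dev r ((Φ N).flow s z)) < c / 2}ᶜ) := by
          rw [Set.union_compl_self]
      _ ≤ _ := measure_union_le _ _
      _ ≤ LG {z | entropyFunctional σ r 1 (fun s _ => psi s) (Φ N) z +
            ∫ x : T3, Hs σ ((fun _ _ => (1 : ℝ)) 0 x) ((fun _ _ => (1 : ℝ)) 0 x) *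
              (fun (s : ℝ) (_ : T3) => psi s) 0 x < c} +
          (LG {z | ENNReal.ofReal (c / 2) ≤ ENNReal.ofReal
            (∫ s in Set.Icc (0 : ℝ) 1, -deriv psi s * Dev r ((Φ N).flow s z))} + LG ((Φ N).good)ᶜ) :=
          add_le_add (measure_mono hAE) ((measure_mono hAc).trans (measure_union_le _ _))
      _ = _ := by rw [hg0, add_zero]
  have h8 : (1 : ℝ≥0∞).toReal ≤ (LG {z | entropyFunctional σ r 1 (fun s _ => psi s) (Φ N) z +
        ∫ x : T3, Hs σ ((fun _ _ => (1 : ℝ)) 0 x) ((fun _ _ => (1 : ℝ)) 0 x) *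
          (fun (s : ℝ) (_ : T3) => psi s) 0 x < c}).toReal +
      (LG {z | ENNReal.ofReal (c / 2) ≤ ENNReal.ofReal
        (∫ s in Set.Icc (0 : ℝ) 1, -deriv psi s * Dev r ((Φ N).flow s z))}).toReal := by
    rw [← ENNReal.toReal_add (measure_ne_top _ _) (measure_ne_top _ _)]
    exact ENNReal.toReal_mono (ENNReal.add_ne_top.2 ⟨measure_ne_top _ _, measure_ne_top _ _⟩) h7
  have h10 : (LG {z | entropyFunctional σ r 1 (fun s _ => psi s) (Φ N) z +
        ∫ x : T3, Hs σ ((fun _ _ => (1 : ℝ)) 0 x) ((fun _ _ => (1 : ℝ)) 0 x) *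
          (fun (s : ℝ) (_ : T3) => psi s) 0 x < c}).toReal ≤ 1 / 2 :=
    ENNReal.toReal_le_of_le_ofReal (by norm_num) h5
  have h14 : (4⁻¹ : ℝ≥0∞) = ENNReal.ofReal (1 / 4) := by
    rw [one_div, ENNReal.ofReal_inv_of_pos (by norm_num : (0 : ℝ) < 4), ENNReal.ofReal_ofNat]
  rw [h14] at hB
  have h11 : (LG {z | ENNReal.ofReal (c / 2) ≤ ENNReal.ofReal
      (∫ s in Set.Icc (0 : ℝ) 1, -deriv psi s * Dev r ((Φ N).flow s z))}).toReal < 1 / 4 :=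
    ENNReal.toReal_lt_of_lt_ofReal hB
  rw [ENNReal.toReal_one] at h8
  linarith


/-- The crux with the REVERSED threshold: `P(I + init < +η) ≤ δ` eventually (a strict entropy GAP).
Verbatim copy of `LocalSecondLaw` with `< -η` replaced by `< η`. -/
def LocalSecondLawStrictGap : Prop :=
  ∀ (a₀ θ₀ : Literature.MathematicalPhysics.KineticTheory.T3 → ℝ) (u₀ : Literature.MathematicalPhysics.KineticTheory.T3 → Literature.MathematicalPhysics.KineticTheory.V3), Continuous a₀ → Continuous θ₀ → Continuous u₀ → (∀ x, 0 < a₀ x) → (∀ x, 0 < θ₀ x) → ∃ σ₀ : ℝ, 0 < σ₀ ∧ ∀ σ : ℝ, 0 < σ → σ < σ₀ → ∀ (T : ℝ) (ρ θ : ℝ → Literature.MathematicalPhysics.KineticTheory.T3 → ℝ) (u : ℝ → Literature.MathematicalPhysics.KineticTheory.T3 → Literature.MathematicalPhysics.KineticTheory.V3), Literature.MathematicalPhysics.KineticTheory.IsHardSphereEulerSolution σ T ρ u θ → ∀ Φ : (N : ℕ) → Literature.Analysis.FluidPDE.HardSphereFlow (Literature.Analysis.FluidPDE.Torus.geometry (Fin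 3)) (Literature.MathematicalPhysics.KineticTheory.hsDiameter σ N) (N + 1), Literature.MathematicalPhysics.KineticTheory.TendstoHydroFieldsAt (fun N => Literature.MathematicalPhysics.KineticTheory.localGibbsLaw σ a₀ u₀ θ₀ N (Φ N)) Φ ρ u θ 0 → 0 < T → ∀ τ : ℝ, 0 < τ → ∀ φ : ℝ → Literature.MathematicalPhysics.KineticTheory.T3 → ℝ, Literature.Analysis.FunctionSpaces.Torus.IsSmoothSpaceTimeOn Set.univ φ → (∀ s x, 0 ≤ φ s x) → (∃ τ' : ℝ, τ' < τ ∧ ∀ s, τ' ≤ s → ∀ x, φ s x = 0) → ∀ η δ : ℝ, 0 < η → 0 < δ → ∃ r₀ : ℝ, 0 < r₀ ∧ ∀ r : ℝ, 0 < r → r < r₀ → ∃ N₀ : ℕ, ∀ N : ℕ, N₀ ≤ N → let γ : Literature.Analysis.FluidPDE.Config (N + 1) (Fin 3) Literature.MathematicalPhysics.KineticTheory.T3 → ℝ → Literature.Analysis.FluidPDE.Config (N + 1) (Fin 3) Literature.MathematicalPhysics.KineticTheory.T3 := fun z s => (Φ N).flow s z; let bx : Literature.MathematicalPhysics.KineticTheory.T3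 → Literature.MathematicalPhysics.KineticTheory.T3 → ℝ := fun x y => 3 / (Real.pi * r ^ 3) * max (1 - Literature.Analysis.FluidPDE.Torus.euclidDist x y / r) 0; let ρm : Literature.Analysis.FluidPDE.Config (N + 1) (Fin 3) Literature.MathematicalPhysics.KineticTheory.T3 → ℝ → Literature.MathematicalPhysics.KineticTheory.T3 → ℝ := fun z s x₀ => ∫ q, bx q.1 x₀ ∂(Literature.Analysis.FluidPDE.empiricalMeasure (γ z s)); let mm : Literature.Analysis.FluidPDE.Config (N + 1) (Fin 3) Literature.MathematicalPhysics.KineticTheory.T3 → ℝ → Literature.MathematicalPhysics.KineticTheory.T3 → Literature.MathematicalPhysics.KineticTheory.V3 := fun z s x₀ => ∫ q, bx q.1 x₀ • q.2 ∂(Literature.Analysis.FluidPDE.empiricalMeasure (γ z s)); let em : Literature.Analysis.FluidPDE.Config (N + 1) (Fin 3) Literature.MathematicalPhysics.KineticTheory.T3 → ℝ → Literature.MathematicalPhysics.KineticTheory.T3 → ℝ := fun z s x₀ => ∫ q, bx q.1 x₀ * (‖q.2‖ ^ 2 / 2) ∂(Literature.Analysis.FluidPDE.empiricalMeasure (γ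 z s)); let θm : Literature.Analysis.FluidPDE.Config (N + 1) (Fin 3) Literature.MathematicalPhysics.KineticTheory.T3 → ℝ → Literature.MathematicalPhysics.KineticTheory.T3 → ℝ := fun z s x₀ => 2 / 3 * (em z s x₀ / ρm z s x₀ - ‖mm z s x₀‖ ^ 2 / (2 * ρm z s x₀ ^ 2)); let Hs : ℝ → ℝ → ℝ := fun a b => if 0 < a ∧ 0 < b then -(a * (3 / 2 * Real.log b - Real.log a - Literature.MathematicalPhysics.KineticTheory.hsExcessFreeEnergy (a * σ ^ 3))) else 0; let I : Literature.Analysis.FluidPDE.Config (N + 1) (Fin 3) Literature.MathematicalPhysics.KineticTheory.T3 → ℝ := fun z => ∫ s in Set.Icc (0 : ℝ) τ, ∫ x : Literature.MathematicalPhysics.KineticTheory.T3, Hs (ρm z s x) (θm z s x) * (deriv (fun s' => φ s' x) s + ∑ k : Fin 3, (mm z s x) k / ρm z s x * Literature.Analysis.FunctionSpaces.Torus.partialDeriv k (φ s) x); Literature.MathematicalPhysics.KineticTheory.localGibbsLaw σ a₀ u₀ θ₀ N (Φ N) {z | I z + ∫ x : Literature.MathematicalPhysics.KineticTheory.T3,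 Hs (ρ 0 x) (θ 0 x) * φ 0 x < η} ≤ ENNReal.ofReal δ

/-- **TIGHTNESS: the strict-gap strengthening of `LocalSecondLaw` is false** — the local entropy
inequality is SATURATED at global equilibrium.  Witness: homogeneous unit local Gibbs data `(1,1,0)`,
the MATCHED constant Euler state `(1,0,1)` (identified `t = 0` LLN), Alexander's flows, `φ(s,x) = ψ(s)`,
`τ = 1`, `η = 1`, `δ = 1/2`, `σ ≤ 1/4`, `r = min(r₀/2, 1/4)`.  On `Φ.good`, `I(z) ≤ J(z) :=
∫₀¹(-ψ') Dev(Φₛz) ds` (`entropyFunctional_le_Dev`, linear majorant of `-H`), the boundary term is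
`f_ex(σ³) ≤ 1/10` (`hsExcessFreeEnergy_le_tenth`), `E_N[J] = E_N[Dev]` (Tonelli through the measurable
modification of the flow + flow-invariance of the homogeneous law, `lintegral_timeIntegral_Dev_eq`) and
`E_N[Dev] → 0` (`tendsto_lintegral_Dev`: `L¹`-LLN for `ρ_r`, Chebyshev + layer cake for `e_r - (3/2)ρ_r`,
dominated convergence over the field point); Markov gives `P_N(J ≥ 9/10) < 1/4` eventually, hence
`P_N(I + init < 1) > 3/4 > 1/2`.  So no proof of the crux can produce a positive entropy gap, and any
argument must be sharp at equilibrium. [folklore] -/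
theorem not_localSecondLawStrictGap : ¬ LocalSecondLawStrictGap := by
  intro h
  refine not_localSecondLawGapAt one_pos ?_
  intro a₀ θ₀ u₀ ha hθ hu ha0 hθ0
  obtain ⟨σ₀, hσ₀, h1⟩ := h a₀ θ₀ u₀ ha hθ hu ha0 hθ0
  refine ⟨σ₀, hσ₀, fun σ hσ hσσ T ρ θ u hsol Φ hT hT0 τ hτ φ hφ hφ0 hsupp η δ _ hδ => ?_⟩
  exact h1 σ hσ hσσ T ρ θ u hsol Φ hT hT0 τ hτ φ hφ hφ0 hsupp 1 δ one_pos hδ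


end Summit.AtomisticToContinuum.HydrodynamicLimit.Theorems.LocalSecondLawNegative

end
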